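import Literature.MathematicalPhysics.QuantumFieldTheory.Balaban1983to89.T4FlagMemory
import Summits.QuantumFields.BalabanUV.T4Continuum.Spine.NE4.AsymptoticContent

/-!
# Spine/NE4/AutonomousScheme — THE AUTONOMOUS (MARKOV-STATE) READING OF NE4: one contraction hypothesis on ONE state space
# gives node U2's whole input list at the contraction rate itself; `T4FlagMemory`'s one-step source `StepShift` is DERIVED

Cell `pub-balaban-gaps` (YM blitz G2), seat `ne4`, generation 9 (unit `pub-balaban-gaps-ne4-g9`); record `HOME/ne/NE4.md` §5 (R42).

HONEST FRAMING.  NE4 = `T4CouplingMatching.ScaleShiftRate c θ γ β` (the η-rate of Bałaban's full β-functions) is NOT IN PRINT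
([Balaban1987RG1] = CMP **109** (1987) p. 264: «We will investigate other properties in a separate paper»; cell GAPS G-t4-U2-1∕-2) and
is NOT proved here.  Every `def … : Prop` below is a HYPOTHESIS SHAPE about an ABSTRACT one-step map on an abstract pseudo-metric
space; every theorem is elementary metric-space bookkeeping (one induction each) or a composition with the spine's consumers BY NAME.
Nothing of Bałaban's is asserted; no status word of the cell moves (NE4 stays DEPENDENT, spine 0∕9).  One finite T⁴; NOT ℝ⁴, NOT
infinite volume, NOT a mass gap, NOT Clay.

THE POINT (ninth reader).  The tree's structural derivation of NE4 from ONE-STEP inputs, `T4FlagMemory` (Literature; the one-step leaves of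
`Support/NE4Transfer*` ∕ `NE4TwoRun*` feed the same shapes), models Bałaban's GROWING
FLAG ([Balaban1987RG1] (0.23) p. 256 — one new entry per step, old entries never rewritten) generated by a k-INDEXED family of one-step
maps `Φ k`, with FOUR unprinted inputs `StepDirect` ∕ `StepMemory` (fading as `C′ω^{age}`) ∕ `StepShift` (the one-step SOURCE of the
scale shift, `src k ≤ aρ^k`, ASSUMED) ∕ `ReadLipschitz`, output rate `ρ` only above the renewal threshold `(1 + C′)ω < ρ`
(`T4FlagMemory.scaleShiftRate_of_scheme`; threshold sharp over all flag data, `T4BetaMemorySharp`).  The k-dependence of `Φ k` is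
faithful to Bałaban's REPRESENTATION (background fields on the η = L^{−k} lattice, propagators `G_k`, covariances `C^{(k)}` of
[Balaban1987RG1] (2.12) p. 268).  But the renormalization transformation ITSELF is k-INDEPENDENT: [Balaban1988Convergent] = CMP **119**
(1988) p. 262, Theorem 1 — «the sequence of densities {ρ_k}, generated by successive applications of the operations RT to the density
ρ₀ = exp[−(1∕g₀²)A − E]» — ONE operation RT applied k times; and the bare density is the same unit-lattice object for every cutoff
(d = 4: `A^ε = A`, [Balaban1987RG1] (0.2) p. 252 «For d = 4 we drop the superscript ε»).  Read this way (Wilson's picture), a run is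
the orbit of ONE map on ONE state space started at ONE bare state, the marginal coupling being carried as a parameter of the step
(it is prescribed on the boxes, as in the inductive hypotheses (I.0.33)); the k-dependence of `β_k` is then NOT an independent datum
but the shadow of the initial condition.  This file kernels exactly that, abstractly:

* §1 `state A ξ g j` — the state after `j` steps of the map `A : ℝ → X → X` (coupling, state ↦ new state) from the bare state `ξ`
  along the coupling sequence `g`; `RepresentsAut A r ξ γ β`: `β k v = r (state A ξ (extd v) (k+1))` (β_{k+1} is read off the state
  the k-th step produces, by a fixed read-out — [Balaban1987RG1] (1.20)–(1.22) p. 264).  Shapes (ALL UNPRINTED, hypotheses only):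
  `Invariant A S γ` (a set of states closed under admissible steps; the reachable set `reach A ξ γ` is the canonical choice, `invariant_reach`), `StateContraction A S θ γ` (at FIXED coupling the step contracts
  `S` by `θ` — «the irrelevant directions contract»), `StateCouplingLipschitz A S ℓ γ`, `FirstStep A ξ D γ` (the first step moves
  the bare state by at most `D`), and `ReadLipschitzOn r S cr` (the read-out Lipschitz ON `S`; `T4FlagMemory.ReadLipschitz` is the global case).
* §2 KERNEL.  `dist_state_shift_le`: run B's state after `j + 1` steps is `Dθ^j`-close to run A's state after `j` steps at the
  infrared-matched couplings — THE SOURCE OF THE SCALE SHIFT IS `θ^j ×` (first-step displacement of the bare state), by one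
  induction (both runs apply the SAME maps to two initial states `A g₀ ξ`, `ξ`).  Hence `scaleShiftRate_of_markov`:
  `ScaleShiftRate (cr·D·θ) θ γ β` — NE4 AT THE CONTRACTION RATE ITSELF, no threshold; `dist_state_le_sum` ∕ `histLipschitz_of_markov`
  ∕ `fadingMemory_of_markov`: moduli `Λ k i = cr·ℓ·θ^{k−i}` with `FadingMemory (cr ℓ) θ Λ` — memory fades at the contraction rate,
  NO renewal window; `ne4_of_markov` packages node U2's triple with ONE rate from THREE constants (θ, ℓ, cr) and `D`;
  `injectedRate_of_markov` composes with the spine's consumer `T4CouplingMatching.injectedRate_of_runs_eventual` (only the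
  AF-weight smallness `cr ℓ((k₀+1)γ³ + 2γ∕b) ≤ (1−θ)∕2` remains); `conv_of_markov`: with the printed one-loop split and the (AF-1)
  corner bound, the β⁰-half (AF-0r) FOLLOWS as well (by `conv_of_scaleShiftRate`, census (R31)) — the one-loop η-rate is a shadow
  of the same contraction.
* §3 FACES ON THE DATA (`Targets` by name): `u2Inputs_of_markov` ∕ `u2Output_under_of_markov` — node U2's input triple and its output
  under the targets' prefix for Bałaban's `D.βfun`, GIVEN a representation of `D.βfun` by such a scheme (unprinted modelling hypothesis).
* (companion file `AutonomousSchemeFlag`, its §4) THE FLAG EMBEDDING — `StepShift` DERIVED: realised as a `T4FlagMemory` scheme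
  (`Markov.toFlag`), the autonomous scheme satisfies `T4FlagMemory.StepShift` with source `θ·D` at the first step and `0` at every
  later step (`Markov.stepShift_toFlag`); fed into `T4FlagMemory.scaleShiftRate_of_scheme` the same data give only every rate
  `ρ > θ` with constant `cr·θD(ρ+θ)∕(ρ−θ)` (`Markov.scaleShiftRate_via_flag`) — the direct argument of §2 is sharper.
* (companion file, its §5) WITNESS ∕ SHARPNESS: the affine scheme `θx + g` on `ℝ` represents the geometric tower `tower θ` of
  `FadingFromRateAnalyticSharp` (census (R34)); its scale shift is exactly `θ^{k+1}·w₀`, so the constant `γθ` and the rate `θ` of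
  `scaleShiftRate_of_markov` are attained (`Markov.markov_rate_exact`).

WHAT THIS SAYS FOR THE ROW (census (R42); classification words UNCHANGED).  Under the autonomous reading, node U2's β-side input
list {NE4, history moduli, fading memory} AND the β⁰-half (AF-0r) are ONE hypothesis — a k-uniform (pseudo-)metric on the states
of the k-independent operation RT in which one step, at fixed marginal coupling in ]0,γ], contracts (rate θ) and is Lipschitz in the
coupling — i.e. the existence of an exponentially attracting «renormalized trajectory» (census (R32): printed as physics lore,
Hasenfratz–Niedermayer 1994 §2.7 rate `1∕4 = L⁻²` observed; Wieczerkowski 1997 §1 «not yet been formalized»); NE4's rate is then the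
contraction rate.  NOT PRINTED for Bałaban's RT in any form: print has SIZE bounds of the new terms ([Balaban1988Convergent] (2.43)
p. 263; [II] Lemma 3 (2.38) p. 20), never a modulus, and p. 262 of [Balaban1988Convergent] sets aside even the weaker
«space_k → space_{k+1}» formulation («This generalization does not seem to be useful, or interesting now»); moreover RT maps densities
on a torus to densities on a torus smaller by `L`, so ONE state space means infinite volume (where [Balaban1987RG1] p. 264 defines
`β_{j+1}`: «we take a limit of these functions as T^{(j+1)} ↗ Z^d») or the family of all tori, and the state must carry the whole
inductive description (small-field actions, `R^{(k)}`, `B^{(k)}`, restrictions `χ_k`).  So the «missing idea» of `HOME/ne/NE4.md` §6 is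
sharpened, not removed: from «a normed formulation of RT between k-dependent spaces with k-uniform Lipschitz constants, at two
spacings» to «a k-uniform metric on ONE space in which the k-independent RT contracts off the marginal direction» — under which the
two-spacing comparison (`StepShift`, rows NE2∕NE3∕NE5's η-differences) is no longer a per-step INPUT with its own rate.  HONEST CAVEAT on that last clause: the
comparison of objects at two spacings does not leave the MATHEMATICS — for Bałaban's representation a k-uniform metric on ONE space of densities must identify
densities represented with background fields on `T_η` and on `T_{η∕L}`, i.e. the η-comparison moves INTO the construction of the metric (and of the invariant set);
what the autonomous reading removes is its role as a separate source term `src k` and the renewal threshold it drags along, not the work of building the space.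
-/

namespace Summit.QuantumFields.BalabanUV.T4Continuum.Spine.NE4

open Literature.MathematicalPhysics.QuantumFieldTheory.Balaban1983to89
open Literature.MathematicalPhysics.QuantumFieldTheory.Balaban1983to89.FlowStep
open Literature.MathematicalPhysics.QuantumFieldTheory.Balaban1983to89.T4CouplingMatching
  (ScaleShiftRate HistLipschitz FadingMemory EventualLowerH disc)
open Literature.MathematicalPhysics.QuantumFieldTheory.Balaban1983to89.T4FlagMemory
  (extd extd_coe extd_adm extd_tail tail_mem_box Adm ReadLipschitz StepShift StepMemory Represents entry flag flag_apply
    entry_def fadingMemory_profile)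
open Finset

namespace Markov

/-! ## §1 The autonomous scheme: states along a coupling sequence, representation, hypothesis shapes -/

section Defs

variable {X : Type*}

/-- The STATE after `j` steps of the (k-independent) one-step map `A` — coupling, state ↦ new state — from the bare state `ξ` along
the coupling sequence `g` (Wilson's picture of [Balaban1988Convergent] p. 262 «successive applications of the operations RT to the
density ρ₀»; which space `X` and which map `A` realise RT is NOT decided here). [folklore] -/
def state (A : ℝ → X → X) (ξ : X) (g : ℕ → ℝ) : ℕ → X
  | 0 => ξ
  | j + 1 => A (g j) (state A ξ g j)

/-- [bookkeeping] The bare state. [folklore] -/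
@[simp] theorem state_zero (A : ℝ → X → X) (ξ : X) (g : ℕ → ℝ) : state A ξ g 0 = ξ := rfl

/-- [bookkeeping] One step. [folklore] -/
@[simp] theorem state_succ (A : ℝ → X → X) (ξ : X) (g : ℕ → ℝ) (j : ℕ) :
    state A ξ g (j + 1) = A (g j) (state A ξ g j) := rfl

/-- [shape] REPRESENTATION HYPOTHESIS (autonomous form of `T4FlagMemory.Represents`): on the boxes, `β_{k+1}(g_0,…,g_k)` is read off
the state produced by the k-th step by a FIXED read-out `r` (the recipe (1.20)–(1.22) of [Balaban1987RG1] p. 264):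
`β k v = r (state A ξ (extd v) (k+1))`.  A MODELLING hypothesis; NOT a fact. [folklore] -/
def RepresentsAut (A : ℝ → X → X) (r : X → ℝ) (ξ : X) (γ : ℝ) (β : HBeta) : Prop :=
  ∀ k (v : Fin (k + 1) → ℝ), v ∈ Box γ k → β k v = r (state A ξ (extd v) (k + 1))

/-- [shape] An INVARIANT set of states: closed under every step at a coupling in ]0,γ] (the abstract stand-in for «the densities
satisfying the inductive assumptions», [Balaban1988Convergent] Thm 1 p. 262).  NOT a fact. [folklore] -/
def Invariant (A : ℝ → X → X) (S : Set X) (γ : ℝ) : Prop :=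
  ∀ g : ℝ, 0 < g → g ≤ γ → ∀ x ∈ S, A g x ∈ S

end Defs

section Shapes

variable {X : Type*} [PseudoMetricSpace X]

/-- [shape] HYPOTHESIS SHAPE (NOT PRINTED in any form): **STATE CONTRACTION** — at FIXED marginal coupling `g ∈ ]0,γ]` one step contracts
the invariant set by `θ`: `dist (A g x) (A g y) ≤ θ·dist x y` («the irrelevant directions contract», uniformly in the step because the
step does not depend on k).  Print has size bounds of the new terms, never a modulus ([Balaban1988Convergent] (2.43) p. 263, and
p. 262 declines the map-between-spaces formulation).  NOT a fact. [folklore] -/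
def StateContraction (A : ℝ → X → X) (S : Set X) (θ γ : ℝ) : Prop :=
  ∀ g : ℝ, 0 < g → g ≤ γ → ∀ x ∈ S, ∀ y ∈ S, dist (A g x) (A g y) ≤ θ * dist x y

/-- [shape] HYPOTHESIS SHAPE (NOT PRINTED as a quantitative statement): the step is LIPSCHITZ IN ITS COUPLING on the invariant set,
`dist (A g x) (A g′ x) ≤ ℓ|g − g′|` (printed qualitative form for the read-out only: [Balaban1987RG1] p. 264 «smooth … uniformly bounded
on this interval together with all derivatives»).  NOT a fact. [folklore] -/
def StateCouplingLipschitz (A : ℝ → X → X) (S : Set X) (ℓ γ : ℝ) : Prop :=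
  ∀ g g' : ℝ, 0 < g → g ≤ γ → 0 < g' → g' ≤ γ → ∀ x ∈ S, dist (A g x) (A g' x) ≤ ℓ * |g - g'|

/-- [shape] HYPOTHESIS SHAPE: the FIRST STEP moves the bare state by at most `D` (at any bare coupling in ]0,γ]) — the only place the
cutoff enters.  NOT a fact. [folklore] -/
def FirstStep (A : ℝ → X → X) (ξ : X) (D γ : ℝ) : Prop :=
  ∀ g : ℝ, 0 < g → g ≤ γ → dist (A g ξ) ξ ≤ D

/-- [shape] HYPOTHESIS SHAPE: the read-out is Lipschitz ON THE INVARIANT SET, `|r x − r x′| ≤ cr·dist x x′` for `x, x′ ∈ S` — the `S`-relative form of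
`T4FlagMemory.ReadLipschitz` (which is the case `S = univ`, `readLipschitzOn_of_readLipschitz`); β is a linear functional of the new term ([Balaban1987RG1]
(1.20)–(1.22) p. 264), controlled only where the inductive description holds.  The constant is NOT PRINTED; NOT a fact. [folklore] -/
def ReadLipschitzOn (r : X → ℝ) (S : Set X) (cr : ℝ) : Prop :=
  ∀ x ∈ S, ∀ x' ∈ S, |r x - r x'| ≤ cr * dist x x'

/-- [bookkeeping] A globally Lipschitz read-out is Lipschitz on every set. [folklore] -/
theorem readLipschitzOn_of_readLipschitz {r : X → ℝ} {cr : ℝ} (h : ReadLipschitz r cr) (S : Set X) :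
    ReadLipschitzOn r S cr := fun x _ x' _ => h x x'

end Shapes

/-! ## §2 Kernel: the scale shift is θ^k × (first-step displacement); NE4 and both history companions at the contraction rate -/

section Kernel

variable {X : Type*} [PseudoMetricSpace X] {A : ℝ → X → X} {S : Set X} {ξ : X} {r : X → ℝ} {β : HBeta}
  {θ ℓ D γ cr : ℝ}

/-- [bookkeeping] An admissible coupling sequence stays admissible after dropping its finest coupling. [folklore] -/
theorem adm_shift {g : ℕ → ℝ} (hg : Adm γ g) : Adm γ (fun m => g (m + 1)) := fun m => hg (m + 1)

omit [PseudoMetricSpace X] in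
/-- [bookkeeping] Along an admissible coupling sequence every state lies in the invariant set. [folklore] -/
theorem state_mem (hInv : Invariant A S γ) (hξ : ξ ∈ S) {g : ℕ → ℝ} (hg : Adm γ g) :
    ∀ j, state A ξ g j ∈ S
  | 0 => hξ
  | j + 1 => hInv (g j) (hg j).1 (hg j).2 _ (state_mem hInv hξ hg j)

omit [PseudoMetricSpace X] in
/-- [bookkeeping] The state after `j` steps depends only on the first `j` couplings. [folklore] -/
theorem state_congr {g g' : ℕ → ℝ} : ∀ j, (∀ m, m < j → g m = g' m) → state A ξ g j = state A ξ g' j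
  | 0, _ => rfl
  | j + 1, h => by
    rw [state_succ, state_succ, h j (Nat.lt_succ_self j), state_congr j fun m hm => h m (Nat.lt_succ_of_lt hm)]

/-- The REACHABLE set of the scheme: every state met along an admissible coupling sequence from the bare state.  The canonical (smallest)
choice of invariant set: the contraction and coupling-Lipschitz shapes need only be checked ALONG ADMISSIBLE ORBITS. [folklore] -/
def reach (A : ℝ → X → X) (ξ : X) (γ : ℝ) : Set X := {x | ∃ g : ℕ → ℝ, Adm γ g ∧ ∃ j, state A ξ g j = x}

omit [PseudoMetricSpace X] in
/-- [bookkeeping] The bare state is reachable (`γ > 0`). [folklore] -/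
theorem mem_reach_bare (hγ : 0 < γ) : ξ ∈ reach A ξ γ := ⟨fun _ => γ, fun _ => ⟨hγ, le_rfl⟩, 0, rfl⟩

omit [PseudoMetricSpace X] in
/-- [bookkeeping] The reachable set IS invariant: `Invariant A (reach A ξ γ) γ` — so `Invariant` is no extra hypothesis when `S = reach A ξ γ`. [folklore] -/
theorem invariant_reach : Invariant A (reach A ξ γ) γ := by
  rintro g hg0 hgγ x ⟨g', hg', j, rfl⟩
  refine ⟨fun m => if m < j then g' m else g, fun m => ?_, j + 1, ?_⟩
  · by_cases h : m < j
    · simp only [h, if_true]; exact hg' m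
    · simp only [h, if_false]; exact ⟨hg0, hgγ⟩
  · rw [state_succ, if_neg (lt_irrefl j), state_congr j fun m hm => by rw [if_pos hm]]

/-- **THE SOURCE OF THE SCALE SHIFT, DERIVED.**  Run B (couplings `g`, one more ultraviolet step) after `j + 1` steps against run A
(couplings `g ∘ succ`) after `j` steps: both have applied the SAME maps `A (g 1), …, A (g j)` — to `A (g 0) ξ` resp. to `ξ` — so under
`StateContraction` the states are `D·θ^j`-close.  One induction; no renewal, no threshold. [folklore] -/
theorem dist_state_shift_le (hθ : 0 ≤ θ) (hInv : Invariant A S γ) (hξ : ξ ∈ S)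
    (hcon : StateContraction A S θ γ) (hfirst : FirstStep A ξ D γ) {g : ℕ → ℝ} (hg : Adm γ g) :
    ∀ j, dist (state A ξ g (j + 1)) (state A ξ (fun m => g (m + 1)) j) ≤ D * θ ^ j := by
  intro j
  induction j with
  | zero => simpa using hfirst (g 0) (hg 0).1 (hg 0).2
  | succ j ih =>
    calc dist (state A ξ g (j + 1 + 1)) (state A ξ (fun m => g (m + 1)) (j + 1))
        = dist (A (g (j + 1)) (state A ξ g (j + 1))) (A (g (j + 1)) (state A ξ (fun m => g (m + 1)) j)) := rfl
      _ ≤ θ * dist (state A ξ g (j + 1)) (state A ξ (fun m => g (m + 1)) j) :=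
          hcon _ (hg (j + 1)).1 (hg (j + 1)).2 _ (state_mem hInv hξ hg (j + 1)) _
            (state_mem hInv hξ (adm_shift hg) j)
      _ ≤ θ * (D * θ ^ j) := mul_le_mul_of_nonneg_left ih hθ
      _ = D * θ ^ (j + 1) := by ring

/-- **NE4 AT THE CONTRACTION RATE (no threshold).**  For a β-family represented by the autonomous scheme with `ReadLipschitzOn r S cr`,
`Invariant A S γ` (∋ ξ), `StateContraction A S θ γ` and `FirstStep A ξ D γ`:
`T4CouplingMatching.ScaleShiftRate (cr·D·θ) θ γ β`.  Bookkeeping over UNPRINTED inputs (`dist_state_shift_le` + `extd_tail`);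
contrast `T4FlagMemory.scaleShiftRate_of_scheme` (source assumed, rate only above `(1 + C′)ω`). [folklore] -/
theorem scaleShiftRate_of_markov (hθ : 0 ≤ θ) (hcr : 0 ≤ cr) (hInv : Invariant A S γ) (hξ : ξ ∈ S)
    (hcon : StateContraction A S θ γ) (hfirst : FirstStep A ξ D γ)
    (hrep : RepresentsAut A r ξ γ β) (hr : ReadLipschitzOn r S cr) :
    ScaleShiftRate (cr * D * θ) θ γ β := by
  intro k w hw
  rw [hrep (k + 1) w hw, hrep k (Fin.tail w) (tail_mem_box hw), extd_tail]
  have h := dist_state_shift_le hθ hInv hξ hcon hfirst (extd_adm hw) (k + 1)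
  calc |r (state A ξ (extd w) (k + 1 + 1)) - r (state A ξ (fun m => extd w (m + 1)) (k + 1))|
      ≤ cr * dist (state A ξ (extd w) (k + 1 + 1)) (state A ξ (fun m => extd w (m + 1)) (k + 1)) :=
        hr _ (state_mem hInv hξ (extd_adm hw) _) _ (state_mem hInv hξ (adm_shift (extd_adm hw)) _)
    _ ≤ cr * (D * θ ^ (k + 1)) := mul_le_mul_of_nonneg_left h hcr
    _ = cr * D * θ * θ ^ k := by ring

/-- **TWO-HISTORY MODULUS OF THE STATES.**  Under `StateContraction A S θ γ` and `StateCouplingLipschitz A S ℓ γ`, for admissible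
`g, g′`: `dist (state g (j+1)) (state g′ (j+1)) ≤ Σ_{i≤j} ℓ·θ^{j−i}·|g_i − g′_i|` — the coupling `g_i` enters the state once (step `i`,
price `ℓ`) and is then contracted `j − i` times.  One induction; compare `T4FlagMemory.dist_entry_le` (profile `((1 + C′)ω)^{j−i}`,
discrete Grönwall on the flag). [folklore] -/
theorem dist_state_le_sum (hθ : 0 ≤ θ) (hInv : Invariant A S γ) (hξ : ξ ∈ S)
    (hcon : StateContraction A S θ γ) (hlip : StateCouplingLipschitz A S ℓ γ)
    {g g' : ℕ → ℝ} (hg : Adm γ g) (hg' : Adm γ g') :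
    ∀ j, dist (state A ξ g (j + 1)) (state A ξ g' (j + 1))
      ≤ ∑ i ∈ range (j + 1), ℓ * θ ^ (j - i) * |g i - g' i| := by
  intro j
  induction j with
  | zero =>
    simpa using hlip (g 0) (g' 0) (hg 0).1 (hg 0).2 (hg' 0).1 (hg' 0).2 ξ hξ
  | succ j ih =>
    have hx : state A ξ g (j + 1) ∈ S := state_mem hInv hξ hg (j + 1)
    have hx' : state A ξ g' (j + 1) ∈ S := state_mem hInv hξ hg' (j + 1)
    calc dist (state A ξ g (j + 1 + 1)) (state A ξ g' (j + 1 + 1))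
        = dist (A (g (j + 1)) (state A ξ g (j + 1))) (A (g' (j + 1)) (state A ξ g' (j + 1))) := rfl
      _ ≤ dist (A (g (j + 1)) (state A ξ g (j + 1))) (A (g' (j + 1)) (state A ξ g (j + 1)))
          + dist (A (g' (j + 1)) (state A ξ g (j + 1))) (A (g' (j + 1)) (state A ξ g' (j + 1))) :=
          dist_triangle _ _ _
      _ ≤ ℓ * |g (j + 1) - g' (j + 1)| + θ * dist (state A ξ g (j + 1)) (state A ξ g' (j + 1)) :=
          add_le_add (hlip _ _ (hg (j + 1)).1 (hg (j + 1)).2 (hg' (j + 1)).1 (hg' (j + 1)).2 _ hx)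
            (hcon _ (hg' (j + 1)).1 (hg' (j + 1)).2 _ hx _ hx')
      _ ≤ ℓ * |g (j + 1) - g' (j + 1)| + θ * ∑ i ∈ range (j + 1), ℓ * θ ^ (j - i) * |g i - g' i| :=
          add_le_add le_rfl (mul_le_mul_of_nonneg_left ih hθ)
      _ = ∑ i ∈ range (j + 1 + 1), ℓ * θ ^ (j + 1 - i) * |g i - g' i| := by
          rw [Finset.sum_range_succ _ (j + 1), Nat.sub_self, pow_zero, mul_one, add_comm, Finset.mul_sum]
          congr 1
          refine Finset.sum_congr rfl fun i hi => ?_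
          have hij : i ≤ j := Nat.lt_succ_iff.mp (mem_range.mp hi)
          rw [show j + 1 - i = (j - i) + 1 by omega, pow_succ]
          ring

/-- **NODE U2's HISTORY MODULI FROM THE AUTONOMOUS SCHEME.**  With `RepresentsAut A r ξ γ β`, `ReadLipschitzOn r S cr` and the shapes:
`T4CouplingMatching.HistLipschitz (fun k i ↦ cr·ℓ·θ^{k−i}) γ β`.  Bookkeeping (`dist_state_le_sum`). [folklore] -/
theorem histLipschitz_of_markov (hθ : 0 ≤ θ) (hcr : 0 ≤ cr) (hInv : Invariant A S γ) (hξ : ξ ∈ S)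
    (hcon : StateContraction A S θ γ) (hlip : StateCouplingLipschitz A S ℓ γ)
    (hrep : RepresentsAut A r ξ γ β) (hr : ReadLipschitzOn r S cr) :
    HistLipschitz (fun k i => cr * ℓ * θ ^ (k - i)) γ β := by
  intro k p q hp hq
  rw [hrep k p hp, hrep k q hq]
  have h := dist_state_le_sum hθ hInv hξ hcon hlip (extd_adm hp) (extd_adm hq) k
  have e : ∑ i : Fin (k + 1), cr * ℓ * θ ^ (k - (i : ℕ)) * |p i - q i|
      = cr * ∑ i ∈ range (k + 1), ℓ * θ ^ (k - i) * |extd p i - extd q i| := by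
    rw [Finset.mul_sum, ← Fin.sum_univ_eq_sum_range]
    refine Finset.sum_congr rfl fun i _ => ?_
    rw [extd_coe, extd_coe]
    ring
  calc |r (state A ξ (extd p) (k + 1)) - r (state A ξ (extd q) (k + 1))|
      ≤ cr * dist (state A ξ (extd p) (k + 1)) (state A ξ (extd q) (k + 1)) :=
        hr _ (state_mem hInv hξ (extd_adm hp) _) _ (state_mem hInv hξ (extd_adm hq) _)
    _ ≤ cr * ∑ i ∈ range (k + 1), ℓ * θ ^ (k - i) * |extd p i - extd q i| := mul_le_mul_of_nonneg_left h hcr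
    _ = ∑ i : Fin (k + 1), cr * ℓ * θ ^ (k - (i : ℕ)) * |p i - q i| := e.symm

/-- The delivered moduli fade AT THE CONTRACTION RATE `θ` (by equality) — no renewal window `(1 + C′)ω < ρ`. [folklore] -/
theorem fadingMemory_of_markov (hθ : 0 ≤ θ) (hcr : 0 ≤ cr) (hℓ : 0 ≤ ℓ) :
    FadingMemory (cr * ℓ) θ (fun k i => cr * ℓ * θ ^ (k - i)) :=
  fadingMemory_profile (mul_nonneg hcr hℓ) hθ

/-- **NE4 FOR A β-FAMILY GENERATED BY AN AUTONOMOUS SCHEME — node U2's three inputs with ONE rate, the contraction rate.**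
`ScaleShiftRate (cr·D·θ) θ γ β ∧ HistLipschitz Λ γ β ∧ FadingMemory (cr ℓ) θ Λ`, `Λ k i = cr·ℓ·θ^{k−i}` — exactly the hypotheses `hS`,
`hL`, `hΛ` of `T4CouplingMatching.injectedRate_of_runs_eventual`, from THREE one-step constants (θ, ℓ, cr) and the first-step
displacement `D`; no `StepShift`, no threshold.  HYPOTHESES ONLY about the scheme. [folklore] -/
theorem ne4_of_markov (hθ : 0 ≤ θ) (hcr : 0 ≤ cr) (hℓ : 0 ≤ ℓ) (hInv : Invariant A S γ) (hξ : ξ ∈ S)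
    (hcon : StateContraction A S θ γ) (hlip : StateCouplingLipschitz A S ℓ γ) (hfirst : FirstStep A ξ D γ)
    (hrep : RepresentsAut A r ξ γ β) (hr : ReadLipschitzOn r S cr) :
    ScaleShiftRate (cr * D * θ) θ γ β ∧
    HistLipschitz (fun k i => cr * ℓ * θ ^ (k - i)) γ β ∧
    FadingMemory (cr * ℓ) θ (fun k i => cr * ℓ * θ ^ (k - i)) :=
  ⟨scaleShiftRate_of_markov hθ hcr hInv hξ hcon hfirst hrep hr,
   histLipschitz_of_markov hθ hcr hInv hξ hcon hlip hrep hr,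
   fadingMemory_of_markov hθ hcr hℓ⟩

/-- **NODE U2's OUTPUT FOR A β-FAMILY GENERATED BY AN AUTONOMOUS SCHEME** (composition with the spine's consumer
`T4CouplingMatching.injectedRate_of_runs_eventual`).  For IR-pinned runs `g K` of the PRINTED recursion (0.20) (`RGEqH`, hypotheses)
in ]0,γ], an eventual lower bound `b ≤ β` from scale `k₀` on (β sub-cell, hypothesis), the autonomous shapes with `0 < θ < 1`, and the
AF-weight smallness `cr ℓ((k₀+1)γ³ + 2γ∕b) ≤ (1 − θ)∕2` (the ONLY smallness left):
`T4CauchySum.InjectedRate (2·cr·D·θ∕(1−θ)) 0 θ (fun K j ↦ disc (g K) (g (K+1)) j)`.  Bookkeeping over UNPRINTED inputs. [folklore] -/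
theorem injectedRate_of_markov {b : ℝ} {k₀ : ℕ} (g : ℕ → ℕ → ℝ) (gIR : ℝ)
    (hγ : 0 < γ) (hb : 0 < b) (hθ0 : 0 < θ) (hθ1 : θ < 1) (hcr : 0 ≤ cr) (hℓ : 0 ≤ ℓ) (hD : 0 ≤ D)
    (hInv : Invariant A S γ) (hξ : ξ ∈ S)
    (hcon : StateContraction A S θ γ) (hlip : StateCouplingLipschitz A S ℓ γ) (hfirst : FirstStep A ξ D γ)
    (hrep : RepresentsAut A r ξ γ β) (hr : ReadLipschitzOn r S cr)
    (hrun : ∀ K, RGEqH K β (g K)) (hbox : ∀ K i, i ≤ K → 0 < g K i ∧ g K i ≤ γ)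
    (hpin : ∀ K, g K K = gIR) (hlo : EventualLowerH b γ k₀ β)
    (hsmall : cr * ℓ * (((k₀ : ℝ) + 1) * γ ^ 3 + 2 * γ / b) ≤ (1 - θ) / 2) :
    T4CauchySum.InjectedRate (2 * (cr * D * θ) / (1 - θ)) 0 θ (fun K j => disc (g K) (g (K + 1)) j) := by
  obtain ⟨hS, hL, hΛ⟩ := ne4_of_markov hθ0.le hcr hℓ hInv hξ hcon hlip hfirst hrep hr
  exact T4CouplingMatching.injectedRate_of_runs_eventual g gIR hγ hb hθ0 hθ1
    (mul_nonneg (mul_nonneg hcr hD) hθ0.le) (mul_nonneg hcr hℓ) hrun hbox hpin hS hL hΛ hlo hsmall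

/-- **THE β⁰-HALF (AF-0r) IS A SHADOW OF THE SAME CONTRACTION.**  With the printed one-loop split `Sp` of `β` ([Balaban1987RG1]
(2.12)–(2.14) p. 268, tree `B12Beta.OneLoopSplit`) and the corner bound `|β¹_{k+1}(p)| ≤ C·g_k` (shape (AF-1)), the autonomous shapes
give `∃ β⁰_∞, |β⁰_{k+1} − β⁰_∞| ≤ (cr·D·θ∕(1−θ))·θ^k` — by `conv_of_scaleShiftRate` (census (R31)).  Bookkeeping over UNPRINTED inputs;
the identification of `β⁰_∞` (row an3) is untouched. [folklore] -/
theorem conv_of_markov (Sp : B12Beta.OneLoopSplit β) {C : ℝ} (hγ : 0 < γ) (hθ0 : 0 ≤ θ) (hθ1 : θ < 1) (hcr : 0 ≤ cr)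
    (hInv : Invariant A S γ) (hξ : ξ ∈ S) (hcon : StateContraction A S θ γ) (hfirst : FirstStep A ξ D γ)
    (hrep : RepresentsAut A r ξ γ β) (hr : ReadLipschitzOn r S cr)
    (hC : ∀ k (p : Fin (k + 1) → ℝ), p ∈ Box γ k → |Sp.β1 k p| ≤ C * p (Fin.last k)) :
    ∃ binf : ℝ, ∀ k, |Sp.β0 k - binf| ≤ cr * D * θ / (1 - θ) * θ ^ k :=
  conv_of_scaleShiftRate Sp hγ hθ1 hC (scaleShiftRate_of_markov hθ0 hcr hInv hξ hcon hfirst hrep hr)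

end Kernel

/-! ## §3 Faces on the data: node U2's input triple and output from an autonomous scheme representing `D.βfun` -/

section Data

open Literature.MathematicalPhysics.QuantumFieldTheory.Balaban1983to89.T4Continuum

universe u

variable {F : T4Family} {G : Type u} [GaugeGroup G] [MeasurableSpace G] [HaarData G]
variable {X : Type*} [PseudoMetricSpace X] {A : ℝ → X → X} {S : Set X} {ξ : X} {r : X → ℝ} {θ ℓ D₁ γ cr : ℝ}

/-- [bookkeeping] **NODE U2's INPUT TRIPLE ON THE DATA from an autonomous scheme REPRESENTING `D.βfun`** (`Targets.U2Inputs` by name):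
constants `c = cr·D₁·θ`, `C = cr·ℓ`, ONE rate `θ`, moduli `cr·ℓ·θ^{k−i}`.  The representation of Bałaban's β by such a scheme is an
UNPRINTED modelling hypothesis; nothing of [Balaban1987RG1] is asserted. [folklore] -/
theorem u2Inputs_of_markov (D : FiniteEpsData F G) (hθ : 0 ≤ θ) (hcr : 0 ≤ cr) (hℓ : 0 ≤ ℓ)
    (hInv : Invariant A S γ) (hξ : ξ ∈ S) (hcon : StateContraction A S θ γ) (hlip : StateCouplingLipschitz A S ℓ γ)
    (hfirst : FirstStep A ξ D₁ γ) (hrep : RepresentsAut A r ξ γ D.βfun) (hr : ReadLipschitzOn r S cr) :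
    U2Inputs D (cr * D₁ * θ) (cr * ℓ) θ γ (fun k i => cr * ℓ * θ ^ (k - i)) :=
  ne4_of_markov hθ hcr hℓ hInv hξ hcon hlip hfirst hrep hr

/-- [bookkeeping] **NODE U2's OUTPUT ON THE DATA UNDER THE TARGETS' PREFIX from an autonomous scheme** (`Targets.u2Output_under` by
name): with the autonomous shapes representing `D.βfun` on `]0,γᵤ]`, `0 < θ < 1`, the eventual lower bound and the printed-type upper
bound there, and the AF-weight smallness `cr ℓ((k₀+1)γᵤ³ + 2γᵤ∕b) ≤ (1−θ)∕2`:
`D.UnderHypotheses Hβ (fun g₀ ↦ U2Output D g₀ (2·cr·D₁·θ∕(1−θ)) θ)`.  Bookkeeping over UNPRINTED inputs. [folklore] -/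
theorem u2Output_under_of_markov (D : FiniteEpsData F G) {Hβ : Prop} {b β' : ℝ} {k₀ : ℕ}
    (hγ : 0 < γ) (hb : 0 < b) (hθ0 : 0 < θ) (hθ1 : θ < 1) (hcr : 0 ≤ cr) (hℓ : 0 ≤ ℓ) (hD₁ : 0 ≤ D₁)
    (hInv : Invariant A S γ) (hξ : ξ ∈ S) (hcon : StateContraction A S θ γ) (hlip : StateCouplingLipschitz A S ℓ γ)
    (hfirst : FirstStep A ξ D₁ γ) (hrep : RepresentsAut A r ξ γ D.βfun) (hr : ReadLipschitzOn r S cr)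
    (hlo : EventualLowerH b γ k₀ D.βfun) (hhi : BetaUpperH β' γ D.βfun) (hγβ : γ ^ 2 * β' < 1)
    (hsmall : cr * ℓ * (((k₀ : ℝ) + 1) * γ ^ 3 + 2 * γ / b) ≤ (1 - θ) / 2) :
    D.UnderHypotheses Hβ fun g₀ => U2Output D g₀ (2 * (cr * D₁ * θ) / (1 - θ)) θ :=
  u2Output_under D (u2Inputs_of_markov D hθ0.le hcr hℓ hInv hξ hcon hlip hfirst hrep hr) hγ hb hθ0 hθ1
    (mul_nonneg (mul_nonneg hcr hD₁) hθ0.le) (mul_nonneg hcr hℓ) hlo hhi hγβ hsmall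

end Data

end Markov

end Summit.QuantumFields.BalabanUV.T4Continuum.Spine.NE4
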